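import Literature.Analysis.FluidPDE.Chen2020DissipativeGCLM
import HarnessLib

/-!
# Huang–Qin–Wang–Wei 2024: exactly self-similar finite-time blow-up of the generalised
# Constantin–Lax–Majda model with interiorly smooth profiles for EVERY `a ≤ 1` — the profile
# equation on the line and the existence theorem (Thm 2.1) as a named fact

HONEST FRAMING (cell ns-blowup GROUP B «PROFILE SEARCH», zone Z3 = the 1-D gCLM/OSW sheet; human rulings
D-0035/D-0074): **1-D MODEL (gCLM/OSW), not Euler/NS.** Nothing in this file is a statement about
Navier–Stokes; it types the printed existence theorem that the inviscid (`ε = 0`) column of the Z3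
line-sheet leans on.

Analysis/FluidPDE statements file (ONE NAMED FACT with cite tag; definitions with bodies; small API and the
elementary consequences proved). Source: De Huang, Xiang Qin, Xiuyuan Wang, Dongyi Wei, *Self-similar
finite-time blowups with smooth profiles of the generalized Constantin–Lax–Majda model*, Arch. Ration. Mech.
Anal. **248** (2024) 22 = arXiv:2305.05895 [HuangQinWangWei2024]. The model is the INVISCID gCLM on the line
(their (1.1)) `ω_t + a u ω_x = u_x ω`, `u_x = H(ω)`, i.e. the `ν = 0` case of `IsGCLMLineSolution` of
`Chen2020DissipativeGCLM.lean`, whose Hilbert transform `lineHilbert` (`Hω(x) = (1/π) P.V.∫ ω(y)/(x−y) dy`,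
their (2.2)) and odd-class velocity `lineVelocity` (`u = ∫₀ˣ Hω`; their `u = −(−Δ)^{−1/2}ω =
(1/π)∫ ω(y) ln|x−y| dy`, which for odd `ω` vanishes at `0`, and (2.5) carries "`u(0) = 0`" explicitly)
this file reuses. The exactly self-similar ansatz (1.2) `ω(x,t) = (T−t)^{c_ω} Ω(x/(T−t)^{c_l})` leads
(§2, first display, "balancing … yields `c_ω = −1`") to the PROFILE EQUATION (2.1)

  `(c_l x + a U) Ω_x = (c_ω + U_x) Ω`,  `U_x = H(Ω)`,  `U(0) = 0`.                              (P)

* `GCLMProfileEqAt a cl cω Ω x` — (P) at the point `x` (definition with body).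
* `huangQinWangWei2024_selfSimilarProfiles` — **Theorem 2.1** (the detailed form of Thm 1.1; p. 6 of the
  arXiv text): "For each `a ≤ 1`, the self-similar equation (2.1) admits a solution `(ω, c_l, c_ω)` with
  `c_ω = −1` and an odd function `ω ∈ L^∞(ℝ) ∩ Ḣ¹(ℝ)` satisfying that `ω′(0) < 0` and that `−ω(x)/x` is
  decreasing in `x` and convex in `x²` on `[0,+∞)`. There is some `a`-dependent number
  `μ_a ∈ (0, min{1, |a|⁻¹})` such that `c_l = (1 − a(2 − μ_a))/(1 − aμ_a)` [`= −1` at `a = 1`, `∈ (−1,1)`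
  for `a ∈ (0,1)`, `= 1` at `a = 0`, `∈ (max{1,|a|}, 1+2|a|)` for `a < 0`]. Depending on the sign of `c_l`,
  one of the following happens: (1) `c_l < 0`: there is some `L_a > 0` such that `ω` is compactly supported
  on `[−L_a, L_a]`, strictly negative on `(0, L_a)`, and smooth in the interior of `(−L_a, L_a)`, and
  `C̄|c_l|^{−1/2} ≤ L_a ≤ C̃|c_l|^{−1/2}` for some absolute constants `C̄, C̃ > 0`. There exist some finite
  numbers `C_a, p_a > 0` such that `lim_{x→L_a−} ω(x)/(L_a−x)^{p_a} = −C_a`, and `p_a ≥ max{(3−a)/(2a),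
  1/a + (1−a)/a·Ĉ L_a²}` for some absolute constant `Ĉ > 0`. (2) `c_l = 0`: `ω` is strictly negative on
  `(0,+∞)` and smooth on `ℝ`, and `ω ∈ H^p(ℝ)` for all `p ≥ 0`. There is some finite number `C_a > 0` such
  that `lim_{x→+∞} ln|ω(x)|/x² = −C_a`. (3) `c_l > 0`: `ω` is strictly negative on `(0,+∞)` and smooth on
  `ℝ`, and `ω′ ∈ H^p(ℝ)` for all `p ≥ 0`. There is some finite number `C_a > 0` such that
  `lim_{x→+∞} x^{1/c_l} ω(x) = −C_a`. Moreover, case (1) must happen for `a > ā`, while case (3) must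
  happen for `a < a̲`, where `a̲ = 400/(848 − 9π²) ≈ 0.5269`, `ā = 64/(176 − 9π²) ≈ 0.7342`."
  Printed mechanism (§3): with `f = −ω/x`, `g = (v/(x v′(0)))₊`, `v = c_l x + a u`, (P) becomes the
  fixed-point problem `f = R_a(f)` of an explicit nonlinear map on a convex compact set `𝔻 ⊂ L^∞_ρ`
  (Schauder; Thm 3.11), `c_l = (1 − a/3)c(f)/2 − a b(f)` (Prop 3.1); §4 (Thms 4.3, 4.10) gives the
  trichotomy, the decay rates and the bounds `a̲, ā` via `μ_a`.
* PROVED here: the amplitude scaling `(αΩ, αc_l, αc_ω)` of (P) ((2.3) with `β = 1`), the printed case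
  values `c_l = 1` at `a = 0` and `c_l = −1` at `a = 1` FROM the fact's formula, the parabolic-scaling
  case `c_l = 1/2 ⇒ a(4 − 3μ_a) = 1, a ∈ (1/4, 1)` (`…cl_formula_eq_half`, `…mem_Ioo_of_cl_eq_half`), the enclosures
  `a̲ ∈ (0.526, 0.527)`, `ā ∈ (0.734, 0.735)`, `a̲ < ā < a*₃-window` (the cell's rung `a*₃ ∈ [0.755272287,
  0.755272288]` of `OkamotoSakajoWunsch2008.AnalyticSeparableProfileA3` lies in the EXPANDING regime
  `c_l < 0` of the line problem), and consumer-shaped extractions of the fact (`…focusing_of_lt_lower`,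
  `…expanding_of_gt_upper`).

## Rendering (read before citing)

* "`ω ∈ L^∞(ℝ)`": `∃ M, ∀ x, |Ω x| ≤ M`; "`ω ∈ Ḣ¹(ℝ)`": `MemLp (deriv Ω) 2` (the profile is smooth off at
  most the two points `±L_a`, so `deriv Ω` is the weak derivative); "`ω ∈ H^p` for all `p ≥ 0`" (case 2):
  every iterated derivative is in `L²` (integer `p` only — weaker); "`ω′ ∈ H^p` for all `p`" (case 3): every
  iterated derivative of order `≥ 1` is in `L²`.
* "solution of (2.1)": (P) holds at EVERY `x` in cases (2), (3) (the profile is smooth on `ℝ`), and at every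
  `x` with `|x| ≠ L_a` in case (1) (smooth inside, identically zero outside, where both sides of (P)
  vanish); the two boundary points, where `ω ∼ −C_a(L_a−x)^{p_a}` need not be `C¹` from both sides when
  `p_a = 1`, are excluded — weaker than any reading of print.
* "`−ω(x)/x` decreasing in `x` and convex in `x²` on `[0,+∞)`": `AntitoneOn (fun x => −Ω x/x) (Ioi 0)` and
  `ConvexOn ℝ (Ioi 0) (fun s => −Ω(√s)/√s)` (open half-line: the value at `0` is the limit `−ω′(0)`; weaker).
* "`μ_a ∈ (0, min{1, |a|⁻¹})`": `0 < μ ∧ μ < 1 ∧ |a|·μ < 1` (so that `a = 0` reads `μ ∈ (0,1)`).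
* "case (1) must happen for `a > ā`, case (3) for `a < a̲`": for the solution the theorem provides,
  `ā < a → c_l < 0` and `a < a̲ → 0 < c_l`.
* `H`, `u`: `lineHilbert`, `lineVelocity` of `Chen2020DissipativeGCLM.lean` (same convention as the source's
  (2.2) and (2.5)); for the theorem's profiles (bounded, with at least algebraic decay `|x|^{−1/c_l}`,
  Hölder-`1/2`) both pieces of the split principal value converge absolutely, so these ARE `H(ω)` and `u`.

## What is deliberately NOT here

No proof of the fact (fixed-point construction §3, fine properties §4; ≈ 25 pages). NOT typed: Theorem 1.1
separately (it is Thm 2.1 minus the quantitative clauses), Corollary 2.2 ("for any `a ≤ a̲` the gCLM can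
develop finite-time singularity from smooth initial data" — it is the `c_l ≥ 0` profile inserted in the
ansatz (1.2); the implication "(P) ⇒ (1.2) solves gCLM" needs the dilation covariance of `H`, not proved
here), Prop 3.1 / Thms 3.7, 3.11, 4.3, 4.10 and Cors 4.4–4.6 (the `μ_a`, `r_a`, `k_a` estimates behind
`a̲, ā`), the `β`-scaling of (2.3) (dilation covariance again). The cited companions — Elgindi–Jeong 2020
(`C^α` profiles for all `a`, smooth for `|a|` small), Chen–Hou–Huang 2021 (`a = 1`), Huang–Tong–Wei 2023
(infinitely many De Gregorio profiles), Lushnikov–Silantyev–Siegel 2021 (numerics, `a_c ≈ 0.6891` between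
`a̲` and `ā`) — are NOT typed here. Nothing here is about Euler or Navier–Stokes.

## References

* D. Huang, X. Qin, X. Wang, D. Wei, Arch. Ration. Mech. Anal. 248 (2024) 22,
  doi:10.1007/s00205-024-01971-3 = arXiv:2305.05895: §1 Thm 1.1 (p. 3), §2 (2.1)–(2.5), Thm 2.1, Cor 2.2
  (p. 6–7 of the held text `paper:arxiv-2305.05895`, chunks 3, 6, 7). [HuangQinWangWei2024]
* J. Chen, Nonlinearity 33 (2020) 2502 (the `a = 1/2` closed form; tree `Chen2020DissipativeGCLM.lean`).
  [Chen2020DissipativeGCLM]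
* P. M. Lushnikov, D. A. Silantyev, M. Siegel, J. Nonlinear Sci. 31 (2021) 82 (`a_c ≈ 0.6891`).
  [LushnikovSilantyevSiegel2021]
* H. Okamoto, T. Sakajo, M. Wunsch, Nonlinearity 21 (2008) 2447 (the parameter `a`). [OkamotoSakajoWunsch2008]
-/

noncomputable section

open _root_.MeasureTheory Set Filter
open scoped Real Topology

namespace Literature.Analysis.FluidPDE

/-! ### The self-similar profile equation of the gCLM on the line -/

/-- The SELF-SIMILAR PROFILE EQUATION (2.1)/(2.5) of the gCLM on the line at the point `x`:
`(c_l x + a U(x))·Ω′(x) = (c_ω + HΩ(x))·Ω(x)` with `U = ∫₀ˣ HΩ` (`U_x = HΩ`, `U(0) = 0`) — the equation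
satisfied by the profile of an exactly self-similar solution `ω(x,t) = (T−t)^{c_ω} Ω(x/(T−t)^{c_l})` of
`ω_t + a u ω_x = u_x ω`, `u_x = Hω`. [cite: HuangQinWangWei2024, eq. (2.1) and (2.5)] -/
def GCLMProfileEqAt (a cl cω : ℝ) (Ω : ℝ → ℝ) (x : ℝ) : Prop :=
  (cl * x + a * lineVelocity Ω x) * deriv Ω x = (cω + lineHilbert Ω x) * Ω x

/-- Unfolding `GCLMProfileEqAt`. [cite: HuangQinWangWei2024, eq. (2.1)] -/
theorem gclmProfileEqAt_iff (a cl cω : ℝ) (Ω : ℝ → ℝ) (x : ℝ) :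
    GCLMProfileEqAt a cl cω Ω x ↔
      (cl * x + a * lineVelocity Ω x) * deriv Ω x = (cω + lineHilbert Ω x) * Ω x :=
  Iff.rfl

/-- The exactly self-similar ansatz (1.2) on the line: `ω(x,t) = (T−t)^{c_ω}·Ω(x/(T−t)^{c_l})` (time first).
[cite: HuangQinWangWei2024, eq. (1.2)] -/
def gclmSelfSimilar (cω cl T : ℝ) (Ω : ℝ → ℝ) (t x : ℝ) : ℝ :=
  (T - t) ^ cω * Ω (x / (T - t) ^ cl)

/-- Unfolding `gclmSelfSimilar`. [cite: HuangQinWangWei2024, eq. (1.2)] -/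
theorem gclmSelfSimilar_def (cω cl T : ℝ) (Ω : ℝ → ℝ) (t x : ℝ) :
    gclmSelfSimilar cω cl T Ω t x = (T - t) ^ cω * Ω (x / (T - t) ^ cl) :=
  rfl

/-- With `c_ω = −1` the ansatz blows up at the rate `(T−t)⁻¹` at every fixed similarity position where the
profile is non-zero: `|ω(t, (T−t)^{c_l}·X)| = |Ω(X)|/(T−t)` for `t < T`.
[cite: HuangQinWangWei2024, eq. (1.2) and §1 ("the only possible non-zero value for `c_ω` is `−1`")] -/
theorem abs_gclmSelfSimilar_neg_one {cl T t : ℝ} (ht : t < T) (Ω : ℝ → ℝ) (X : ℝ) :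
    |gclmSelfSimilar (-1) cl T Ω t ((T - t) ^ cl * X)| = |Ω X| / (T - t) := by
  have hpos : 0 < T - t := sub_pos.2 ht
  have hne : (T - t) ^ cl ≠ 0 := (Real.rpow_pos_of_pos hpos cl).ne'
  simp only [gclmSelfSimilar]
  rw [mul_div_cancel_left₀ X hne, Real.rpow_neg_one, abs_mul, abs_inv, abs_of_pos hpos]
  ring

/-- AMPLITUDE SCALING of the profile equation ((2.3) with `β = 1`): if `(Ω, c_l, c_ω)` solves (P) at `x` then
so does `(αΩ, αc_l, αc_ω)` — both sides scale by `α²`, `H` and `U` being linear. ("Owing to this scaling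
property, we will release ourselves from the restriction that `c_ω = −1`. In fact, it is the ratio `c_l/c_ω`
that matters.") [cite: HuangQinWangWei2024, eq. (2.3)] -/
theorem GCLMProfileEqAt.smul {a cl cω : ℝ} {Ω : ℝ → ℝ} {x : ℝ} (h : GCLMProfileEqAt a cl cω Ω x)
    (α : ℝ) : GCLMProfileEqAt a (α * cl) (α * cω) (fun y => α * Ω y) x := by
  simp only [GCLMProfileEqAt] at h ⊢
  rw [lineVelocity_const_mul, lineHilbert_const_mul, deriv_const_mul_field']
  have : (α * cl * x + a * (α * lineVelocity Ω x)) * (α * deriv Ω x) =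
      α * α * ((cl * x + a * lineVelocity Ω x) * deriv Ω x) := by ring
  rw [this, h]
  ring

/-! ### The thresholds `a̲`, `ā` of Theorem 2.1 -/

/-- `a̲ = 400/(848 − 9π²) ≈ 0.5269`: below it the Theorem-2.1 profile is of FOCUSING type `c_l > 0`
(smooth on `ℝ`, algebraic tail). [cite: HuangQinWangWei2024, Thm 2.1] -/
def hqwwLower : ℝ := 400 / (848 - 9 * π ^ 2)

/-- `ā = 64/(176 − 9π²) ≈ 0.7342`: above it the Theorem-2.1 profile is of EXPANDING type `c_l < 0`
(compactly supported, interiorly smooth). [cite: HuangQinWangWei2024, Thm 2.1] -/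
def hqwwUpper : ℝ := 64 / (176 - 9 * π ^ 2)

/-- Enclosure `a̲ ∈ (0.526, 0.527)` (print: "≈ 0.5269"). [cite: HuangQinWangWei2024, Thm 2.1] -/
theorem hqwwLower_mem_Ioo : hqwwLower ∈ Ioo (0.526 : ℝ) 0.527 := by
  have h1 : (3.14159 : ℝ) < π := by linarith [Real.pi_gt_d6]
  have h2 : π < (3.1416 : ℝ) := by linarith [Real.pi_lt_d6]
  have hsq1 : (3.14159 : ℝ) ^ 2 < π ^ 2 := by nlinarith
  have hsq2 : π ^ 2 < (3.1416 : ℝ) ^ 2 := by nlinarith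
  have hden : 0 < 848 - 9 * π ^ 2 := by nlinarith
  unfold hqwwLower
  constructor
  · rw [lt_div_iff₀ hden]; nlinarith
  · rw [div_lt_iff₀ hden]; nlinarith

/-- Enclosure `ā ∈ (0.734, 0.735)` (print: "≈ 0.7342"). [cite: HuangQinWangWei2024, Thm 2.1] -/
theorem hqwwUpper_mem_Ioo : hqwwUpper ∈ Ioo (0.734 : ℝ) 0.735 := by
  have h1 : (3.14159 : ℝ) < π := by linarith [Real.pi_gt_d6]
  have h2 : π < (3.1416 : ℝ) := by linarith [Real.pi_lt_d6]
  have hsq1 : (3.14159 : ℝ) ^ 2 < π ^ 2 := by nlinarith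
  have hsq2 : π ^ 2 < (3.1416 : ℝ) ^ 2 := by nlinarith
  have hden : 0 < 176 - 9 * π ^ 2 := by nlinarith
  unfold hqwwUpper
  constructor
  · rw [lt_div_iff₀ hden]; nlinarith
  · rw [div_lt_iff₀ hden]; nlinarith

/-- `0 < a̲ < ā < 1`. [cite: HuangQinWangWei2024, Thm 2.1] -/
theorem hqwwLower_lt_hqwwUpper : 0 < hqwwLower ∧ hqwwLower < hqwwUpper ∧ hqwwUpper < 1 := by
  have hl := hqwwLower_mem_Ioo
  have hu := hqwwUpper_mem_Ioo
  exact ⟨by linarith [hl.1], by linarith [hl.2, hu.1], by linarith [hu.2]⟩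

/-- The cell's certified circle rung `a*₃ ∈ [0.755272287, 0.755272288]` (the window of
`OkamotoSakajoWunsch2008.AnalyticSeparableProfileA3`) and LSS's numerical threshold `a_c ≈ 0.6891` sit as
`a̲ < 0.6891 < ā < 0.755272287`: on the LINE, Theorem 2.1's profile at any `a ≥ 0.755272287` is of the
expanding type `c_l < 0`. (Arithmetic on the printed constants only.) [cite: HuangQinWangWei2024, Thm 2.1] -/
theorem hqwwUpper_lt_rung_window : hqwwLower < 0.6891 ∧ (0.6891 : ℝ) < hqwwUpper ∧
    hqwwUpper < 0.755272287 := by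
  have hl := hqwwLower_mem_Ioo
  have hu := hqwwUpper_mem_Ioo
  exact ⟨by linarith [hl.2], by linarith [hu.1], by linarith [hu.2]⟩

/-! ### Theorem 2.1 as a named fact -/

/-- The three printed PROFILE TYPES of Theorem 2.1, as a predicate on `(a, Ω, c_l)` together with the
absolute constants `C̄, C̃, Ĉ` of case (1): (1) `c_l < 0` — compact support `[−L, L]` with
`C̄|c_l|^{−1/2} ≤ L ≤ C̃|c_l|^{−1/2}`, `Ω < 0` on `(0,L)`, smooth on `(−L,L)`, (P) at every `|x| ≠ L`,
vanishing order `p ≥ max{(3−a)/(2a), 1/a + (1−a)/a·ĈL²}` at `L` with `Ω(x)/(L−x)^p → −C < 0`;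
(2) `c_l = 0` — `Ω < 0` on `(0,∞)`, smooth, all derivatives in `L²`, (P) everywhere,
`ln|Ω(x)|/x² → −C < 0`; (3) `c_l > 0` — `Ω < 0` on `(0,∞)`, smooth, all derivatives of order `≥ 1` in `L²`,
(P) everywhere, `x^{1/c_l}Ω(x) → −C < 0`. [cite: HuangQinWangWei2024, Thm 2.1 (cases (1)–(3))] -/
def HQWWProfileType (Cbar Ctil Chat a : ℝ) (Ω : ℝ → ℝ) (cl : ℝ) : Prop :=
  (cl < 0 ∧ ∃ L : ℝ, 0 < L ∧ Cbar * |cl| ^ (-(1 / 2 : ℝ)) ≤ L ∧ L ≤ Ctil * |cl| ^ (-(1 / 2 : ℝ)) ∧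
      (∀ x : ℝ, L ≤ |x| → Ω x = 0) ∧ (∀ x ∈ Ioo 0 L, Ω x < 0) ∧ ContDiffOn ℝ (⊤ : ℕ∞) Ω (Ioo (-L) L) ∧
      (∀ x : ℝ, |x| ≠ L → GCLMProfileEqAt a cl (-1) Ω x) ∧
      ∃ C p : ℝ, 0 < C ∧ 0 < p ∧ max ((3 - a) / (2 * a)) (1 / a + (1 - a) / a * Chat * L ^ 2) ≤ p ∧
        Tendsto (fun x => Ω x / (L - x) ^ p) (𝓝[<] L) (𝓝 (-C))) ∨
  (cl = 0 ∧ (∀ x : ℝ, 0 < x → Ω x < 0) ∧ ContDiff ℝ (⊤ : ℕ∞) Ω ∧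
      (∀ n : ℕ, MemLp (iteratedDeriv n Ω) 2 volume) ∧ (∀ x : ℝ, GCLMProfileEqAt a cl (-1) Ω x) ∧
      ∃ C : ℝ, 0 < C ∧ Tendsto (fun x => Real.log |Ω x| / x ^ 2) atTop (𝓝 (-C))) ∨
  (0 < cl ∧ (∀ x : ℝ, 0 < x → Ω x < 0) ∧ ContDiff ℝ (⊤ : ℕ∞) Ω ∧
      (∀ n : ℕ, MemLp (iteratedDeriv (n + 1) Ω) 2 volume) ∧ (∀ x : ℝ, GCLMProfileEqAt a cl (-1) Ω x) ∧
      ∃ C : ℝ, 0 < C ∧ Tendsto (fun x => x ^ (1 / cl) * Ω x) atTop (𝓝 (-C)))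

/-- **Huang–Qin–Wang–Wei 2024, Theorem 2.1** (Arch. Ration. Mech. Anal. 248 (2024) 22 = arXiv:2305.05895,
§2; verbatim in the module docstring: for each `a ≤ 1` the profile equation (2.1) has a solution
`(ω, c_l, c_ω)` with `c_ω = −1`, `ω` odd in `L^∞ ∩ Ḣ¹`, `ω′(0) < 0`, `−ω(x)/x` decreasing in `x` and convex in
`x²` on `[0,∞)`, `c_l = (1 − a(2−μ_a))/(1 − aμ_a)` for some `μ_a ∈ (0, min{1,|a|⁻¹})`, of one of the three
types (1) `c_l < 0` compactly supported / (2) `c_l = 0` Gaussian-like decay / (3) `c_l > 0` algebraic tail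
`|x|^{−1/c_l}`, with type (1) for `a > ā = 64/(176−9π²)` and type (3) for `a < a̲ = 400/(848−9π²)`; proof:
§3 fixed point `f = R_a(f)` of an explicit map on a convex compact subset of a weighted `L^∞` (Schauder),
§4 fine properties.) **Statement** (rendering in the module docstring): there are absolute constants
`C̄, C̃, Ĉ > 0` such that for every `a ≤ 1` there exist an odd bounded `Ω : ℝ → ℝ` with `Ω′ ∈ L²`,
`Ω′(0) < 0`, `−Ω(x)/x` antitone and convex-in-`x²` on `(0,∞)`, and numbers `c_l`, `μ` with `0 < μ < 1`,
`|a|μ < 1`, `c_l = (1 − a(2−μ))/(1 − aμ)`, `ā < a → c_l < 0`, `a < a̲ → 0 < c_l`, and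
`HQWWProfileType C̄ C̃ Ĉ a Ω c_l` (the trichotomy with its printed clauses, profile equation (P) with
`c_ω = −1` included). Honest framing: 1-D MODEL, not Euler/NS. [cite: HuangQinWangWei2024, Thm 2.1] -/
def huangQinWangWei2024_selfSimilarProfiles : Prop :=
  ∃ Cbar Ctil Chat : ℝ, 0 < Cbar ∧ 0 < Ctil ∧ 0 < Chat ∧
    ∀ a : ℝ, a ≤ 1 →
      ∃ (Ω : ℝ → ℝ) (cl μ : ℝ),
        Function.Odd Ω ∧ (∃ M : ℝ, ∀ x, |Ω x| ≤ M) ∧ MemLp (deriv Ω) 2 volume ∧ deriv Ω 0 < 0 ∧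
        AntitoneOn (fun x => -Ω x / x) (Ioi 0) ∧
        ConvexOn ℝ (Ioi 0) (fun s => -Ω (Real.sqrt s) / Real.sqrt s) ∧
        0 < μ ∧ μ < 1 ∧ |a| * μ < 1 ∧ cl = (1 - a * (2 - μ)) / (1 - a * μ) ∧
        (hqwwUpper < a → cl < 0) ∧ (a < hqwwLower → 0 < cl) ∧
        HQWWProfileType Cbar Ctil Chat a Ω cl

/-! ### Consequences (proved from the fact) -/

/-- The printed case `a = 0` of (2.2): the formula forces `c_l = 1` (the Constantin–Lax–Majda scaling
`c_l = −c_ω = 1` of Elgindi–Jeong's exact solution). [cite: HuangQinWangWei2024, Thm 2.1 (eq. (2.2), case `a = 0`)] -/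
theorem huangQinWangWei2024_selfSimilarProfiles.cl_formula_zero {cl μ : ℝ}
    (h : cl = (1 - 0 * (2 - μ)) / (1 - 0 * μ)) : cl = 1 := by
  rw [h]; norm_num

/-- The printed case `a = 1` of (2.2): the formula forces `c_l = −1` (the De Gregorio scaling
`c_l = c_ω = −1` of Chen–Hou–Huang), whatever `μ ∈ (0,1)`. [cite: HuangQinWangWei2024, Thm 2.1 (eq. (2.2), case `a = 1`)] -/
theorem huangQinWangWei2024_selfSimilarProfiles.cl_formula_one {cl μ : ℝ} (hμ : μ < 1)
    (h : cl = (1 - 1 * (2 - μ)) / (1 - 1 * μ)) : cl = -1 := by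
  rw [h]
  have hne : 1 - μ ≠ 0 := by linarith [sub_pos.2 hμ] |> fun h' => ne_of_gt h'
  field_simp
  ring

/-- The printed case `a ∈ (0,1)` of (2.2): `c_l ∈ (−1, 1)` follows from the formula with `0 < μ < 1`,
`aμ < 1`. [cite: HuangQinWangWei2024, Thm 2.1 (eq. (2.2), case `0 < a < 1`)] -/
theorem huangQinWangWei2024_selfSimilarProfiles.cl_formula_mem_Ioo {a cl μ : ℝ} (ha0 : 0 < a) (ha1 : a < 1)
    (hμ0 : 0 < μ) (hμ1 : μ < 1) (h : cl = (1 - a * (2 - μ)) / (1 - a * μ)) : cl ∈ Ioo (-1 : ℝ) 1 := by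
  have hden : 0 < 1 - a * μ := by nlinarith
  have haμ : 0 < a * μ := mul_pos ha0 hμ0
  rw [h]
  constructor
  · rw [lt_div_iff₀ hden]; nlinarith
  · rw [div_lt_iff₀ hden]; nlinarith

/-- The printed formula (2.2) at the PARABOLIC scaling `c_l = 1/2` (the scaling at which a constant
viscosity is self-similarly invariant, Chen 2020 §2.1): `(1 − a(2−μ))/(1 − aμ) = 1/2` with `|a|μ < 1` forces
`a(4 − 3μ) = 1` (`μ > 0` as in the theorem). [cite: HuangQinWangWei2024, Thm 2.1 (eq. (2.2), evaluated at `c_l = 1/2`)] -/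
theorem huangQinWangWei2024_selfSimilarProfiles.cl_formula_eq_half {a cl μ : ℝ} (hμ0 : 0 < μ)
    (haμ : |a| * μ < 1) (h : cl = (1 - a * (2 - μ)) / (1 - a * μ)) (hcl : cl = 1 / 2) :
    a * (4 - 3 * μ) = 1 := by
  have hden : 1 - a * μ ≠ 0 := by
    have : a * μ ≤ |a| * μ := mul_le_mul_of_nonneg_right (le_abs_self a) hμ0.le
    intro h0
    linarith
  rw [hcl, eq_div_iff hden] at h
  linear_combination (2 : ℝ) * h

/-- Hence a Theorem-2.1-type profile AT the parabolic scaling `c_l = 1/2` can only occur for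
`a = 1/(4 − 3μ_a) ∈ (1/4, 1)` (`μ_a ∈ (0,1)`, `|a|μ_a < 1`): the formula alone places the inviscid `c_l = 1/2`
profiles of this type in `a ∈ (1/4, 1)` — it says nothing about uniqueness in `a`.
[cite: HuangQinWangWei2024, Thm 2.1 (eq. (2.2), evaluated at `c_l = 1/2`)] -/
theorem huangQinWangWei2024_selfSimilarProfiles.mem_Ioo_of_cl_eq_half {a cl μ : ℝ} (hμ0 : 0 < μ)
    (hμ1 : μ < 1) (haμ : |a| * μ < 1) (h : cl = (1 - a * (2 - μ)) / (1 - a * μ)) (hcl : cl = 1 / 2) :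
    a ∈ Ioo (1 / 4 : ℝ) 1 := by
  have key := huangQinWangWei2024_selfSimilarProfiles.cl_formula_eq_half hμ0 haμ h hcl
  have h43 : 0 < 4 - 3 * μ := by linarith
  have ha0 : 0 < a := by nlinarith
  constructor <;> nlinarith

/-- FOCUSING REGIME, consumer form: under the fact, for every `a < a̲` (in particular every `a ≤ 0.526`)
the line gCLM has an odd profile `Ω`, SMOOTH ON `ℝ`, strictly negative on `(0,∞)`, `Ω′(0) < 0`, solving (P)
with `c_ω = −1` at every point, with `c_l > 0` and the algebraic tail `x^{1/c_l}Ω(x) → −C < 0` — an exactly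
self-similar FOCUSING blow-up `ω = (T−t)⁻¹Ω(x/(T−t)^{c_l})` with a smooth profile. [cite: HuangQinWangWei2024, Thm 2.1 and Cor 2.2] -/
theorem huangQinWangWei2024_selfSimilarProfiles.focusing_of_lt_lower
    (h : huangQinWangWei2024_selfSimilarProfiles) {a : ℝ} (ha : a < hqwwLower) :
    ∃ (Ω : ℝ → ℝ) (cl : ℝ), 0 < cl ∧ Function.Odd Ω ∧ ContDiff ℝ (⊤ : ℕ∞) Ω ∧ deriv Ω 0 < 0 ∧
      (∀ x : ℝ, 0 < x → Ω x < 0) ∧ (∀ x : ℝ, GCLMProfileEqAt a cl (-1) Ω x) ∧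
      ∃ C : ℝ, 0 < C ∧ Tendsto (fun x => x ^ (1 / cl) * Ω x) atTop (𝓝 (-C)) := by
  obtain ⟨Cbar, Ctil, Chat, -, -, -, hall⟩ := h
  have ha1 : a ≤ 1 := by linarith [hqwwLower_lt_hqwwUpper.2.1, hqwwLower_lt_hqwwUpper.2.2]
  obtain ⟨Ω, cl, μ, hodd, -, -, hder, -, -, -, -, -, -, -, hlow, htype⟩ := hall a ha1
  have hcl : 0 < cl := hlow ha
  rcases htype with ⟨hneg, -⟩ | ⟨hzero, -⟩ | ⟨-, hsign, hsmooth, -, heq, C, hC, hlim⟩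
  · exact absurd hneg (not_lt.2 hcl.le)
  · exact absurd hzero hcl.ne'
  · exact ⟨Ω, cl, hcl, hodd, hsmooth, hder, hsign, heq, C, hC, hlim⟩

/-- EXPANDING REGIME, consumer form: under the fact, for every `a ∈ (ā, 1]` (in particular at the cell's
circle rung window `a ≥ 0.755272287`, see `hqwwUpper_lt_rung_window`) the line gCLM has an odd, compactly
supported, interiorly smooth profile with `c_l < 0`, solving (P) with `c_ω = −1` off the two support
endpoints. [cite: HuangQinWangWei2024, Thm 2.1] -/
theorem huangQinWangWei2024_selfSimilarProfiles.expanding_of_gt_upper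
    (h : huangQinWangWei2024_selfSimilarProfiles) {a : ℝ} (ha : hqwwUpper < a) (ha1 : a ≤ 1) :
    ∃ (Ω : ℝ → ℝ) (cl L : ℝ), cl < 0 ∧ 0 < L ∧ Function.Odd Ω ∧ deriv Ω 0 < 0 ∧
      (∀ x : ℝ, L ≤ |x| → Ω x = 0) ∧ (∀ x ∈ Ioo 0 L, Ω x < 0) ∧ ContDiffOn ℝ (⊤ : ℕ∞) Ω (Ioo (-L) L) ∧
      (∀ x : ℝ, |x| ≠ L → GCLMProfileEqAt a cl (-1) Ω x) := by
  obtain ⟨Cbar, Ctil, Chat, -, -, -, hall⟩ := h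
  obtain ⟨Ω, cl, μ, hodd, -, -, hder, -, -, -, -, -, -, hup, -, htype⟩ := hall a ha1
  have hcl : cl < 0 := hup ha
  rcases htype with ⟨-, L, hL, -, -, hsupp, hsign, hsmooth, heq, -⟩ | ⟨hzero, -⟩ | ⟨hpos, -⟩
  · exact ⟨Ω, cl, L, hcl, hL, hodd, hder, hsupp, hsign, hsmooth, heq⟩
  · exact absurd hzero hcl.ne
  · exact absurd hpos (not_lt.2 hcl.le)

/-- In every case the profile of the fact solves (P) with `c_ω = −1` on a neighbourhood of the origin
(inside `(−L, L)` in case (1), everywhere in cases (2)–(3)): for every `a ≤ 1` there are an odd `Ω` with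
`Ω′(0) < 0`, a `c_l` and an `ε > 0` with (P) at every `|x| < ε`. [cite: HuangQinWangWei2024, Thm 2.1] -/
theorem huangQinWangWei2024_selfSimilarProfiles.eq_near_zero
    (h : huangQinWangWei2024_selfSimilarProfiles) {a : ℝ} (ha1 : a ≤ 1) :
    ∃ (Ω : ℝ → ℝ) (cl ε : ℝ), 0 < ε ∧ Function.Odd Ω ∧ deriv Ω 0 < 0 ∧
      ∀ x : ℝ, |x| < ε → GCLMProfileEqAt a cl (-1) Ω x := by
  obtain ⟨Cbar, Ctil, Chat, -, -, -, hall⟩ := h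
  obtain ⟨Ω, cl, μ, hodd, -, -, hder, -, -, -, -, -, -, -, -, htype⟩ := hall a ha1
  rcases htype with ⟨-, L, hL, -, -, -, -, -, heq, -⟩ | ⟨-, -, -, -, heq, -⟩ | ⟨-, -, -, -, heq, -⟩
  · exact ⟨Ω, cl, L, hL, hodd, hder, fun x hx => heq x (ne_of_lt hx)⟩
  · exact ⟨Ω, cl, 1, one_pos, hodd, hder, fun x _ => heq x⟩
  · exact ⟨Ω, cl, 1, one_pos, hodd, hder, fun x _ => heq x⟩

end Literature.Analysis.FluidPDE
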